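import Literature.AnabelianGeometry.EtaleTheta.Discharge.Sec2TwistedModelTempered
import Literature.AnabelianGeometry.EtaleTheta.ThetaCoversProp22iSignToyIndependence
import HarnessLib

/-!
# [EtTh] Cor 2.9, last sentence (`TemperedCoverData.Cor29_preserved`, FACT-LIST row F-0601): the universal closure
# over the typed interface is FALSE — the twisted NV-L2 model and the verdict

S. Mochizuki, *The étale theta function and its Frobenioid-theoretic manifestations*, Publ. RIMS **45** (2009)
[MochizukiEtTh2009], §2, Cor. 2.9 p.43 (PDF): "for `X̲̲, C̲, C̲̲` these bijections [labels `(ℤ/lℤ)^±` ↔ `Aut_K`-orbits of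
cusps] are preserved by arbitrary isomorphisms `γ` as in Corollary 2.8".  abc-iut-L2-t2 typed it (one-object form) as
`TemperedCoverData.Cor29_preserved`: every topological automorphism `Γ` of `Π^tp_C` stabilising the Prop 2.4 list of the
member and the cusp stabiliser `cuspStabC = N_{Π^tp_C}(tp D_x)` acts TRIVIALLY on the double-coset space
`N(Π^tp_Z) \ Π^tp_C / cuspStabC`.  abc-iut cell, block F (fact-proving wave), seat abc-iut-f-142, tranche 142 of
`plan/F-TRANCHES.tsv`; PROOF-ONLY (0 definitions; the model's data are the `def`s of `ThetaCoversTwistedModelDefs.lean`).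

WHAT IS PROVED (schema verdict, R5).  `exists_model_not_cor29_preserved`: for every odd `l ≥ 3` the TWISTED NV-L2 model
(`ThetaCoversTwistedModelDefs.lean`, `Discharge/Sec2TwistedModel{Theta,Tempered}.lean`: finite factor
`B = ((ℤ/l)² ⋊ heisPiC l) × ℤ/2`, `Π^tp_C = B × ℤ ↪ Π_C = B × Ẑ`, `G_K = 1`, cusp decomposition group
`D_x = ⟨(m₀, η_ℤ 1)⟩`) is a `T : TemperedCoverData l` with `K ⊇ μ_l` (`HasMuL`), whose cusp stabiliser is the proper normal
subgroup `Π^tp_{X̲} = Φ⁻¹((ℤ/l)² ⋊ 1)`, and at which `T.Cor29_preserved` FAILS: for the member `C̲` (second entry of the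
typed list), conjugation by the inversion `ι̲ ∈ Π^tp_{C̲}` is a topological automorphism `Γ` of `Π^tp_C` stabilising
`Π^tp_{C̲}, Π^tp_{X̲}, Π^tp_X, Π^tp_Ÿ` and `cuspStabC`, yet it maps the double coset of a lift `g` of the rotation `r¹`
to that of a lift of `r⁻¹` — and the rotation index `∈ ℤ/l` of the `D_l`-part is an invariant of
`N(Π^tp_{C̲}) · g · cuspStabC` (normalising elements have `D_l`-part `1` or `s`; stabilising ones have trivial `D_l`-part),
`1 ≠ −1` for `l ≥ 3`.  Hence `not_forall_cor29_preserved`: **the universal closure of F-0601 over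
`T : TemperedCoverData l` is false** (`l` odd, `l ≥ 3`; closed form at `l = 3`).  Companion (abc-iut-f-142 gen 0,
`Sec2TemperedModelAutomorphisms.lean`): the closure HOLDS at w5-d118's untwisted model (degenerate `cuspStabC = ⊤`), so
the row is INDEPENDENT of the interface + `HasMuL`.

READING (honest label).  In print the preservation holds because the labels are distances in the dual graph of the
special fibre, a structure the typed interface `TemperedCoverData` does not carry; the verdict is about the TYPED schema
only (consumed BY NAME inside abc-iut-L2), not about [EtTh] Cor. 2.9.  no side taken on [IUTchIII] Cor 3.12; typed ≠ proved.
-/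

noncomputable section

namespace Literature.AnabelianGeometry.EtaleTheta

namespace ThetaCovers

namespace TwistedModel

open Multiplicative HeisenbergWitness Literature.AnabelianGeometry.SemiGraphs
  Literature.AnabelianGeometry.EtaleTheta.SettingModel TemperedModel

variable (l : ℕ) [NeZero l]

/-! ## 1. Dihedral bookkeeping: normalising `Π^tp_{C̲}` forces `D_l`-part `∈ {1, s}`; the rotation-index invariant -/

omit [NeZero l] in
/-- In `D_l` (`l` odd) the reflection `s = s r⁰` is conjugate to itself only by `1` and `s`: `d s d⁻¹ ∈ {1, s} → d ∈ {1, s}`.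
(toy bookkeeping; `i + i = 0 ⇒ i = 0` is abc-iut's `SignToy.eq_zero_of_add_self`) [cite: MochizukiEtTh2009, Cor 2.9 p.43] -/
theorem dihedral_conj_sr_zero (hl : Odd l) {d : DihedralGroup l}
    (h : d * DihedralGroup.sr 0 * d⁻¹ = 1 ∨ d * DihedralGroup.sr 0 * d⁻¹ = DihedralGroup.sr 0) :
    d = 1 ∨ d = DihedralGroup.sr 0 := by
  rcases d with i | i
  · simp only [DihedralGroup.inv_r, DihedralGroup.r_mul_sr, DihedralGroup.sr_mul_r, DihedralGroup.one_def,
      reduceCtorEq, DihedralGroup.sr.injEq, false_or, zero_sub] at h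
    left
    rw [DihedralGroup.one_def, DihedralGroup.r.injEq]
    have h' : i + i = 0 := by
      have := congrArg (fun j => -j) h
      simpa using this
    exact SignToy.eq_zero_of_add_self hl h'
  · simp only [DihedralGroup.inv_sr, DihedralGroup.sr_mul_sr, DihedralGroup.r_mul_sr, DihedralGroup.one_def,
      reduceCtorEq, DihedralGroup.sr.injEq, false_or, zero_sub, sub_neg_eq_add] at h
    right
    rw [DihedralGroup.sr.injEq]
    exact SignToy.eq_zero_of_add_self hl h

omit [NeZero l] in
/-- **An element of `Π^tp_C` normalising `Π^tp_{C̲} = Φ^tp⁻¹((ℤ/l)² ⋊ {1, s})` has `D_l`-part `1` or `s`** (it conjugates the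
inversion `ι̲ ∈ Π^tp_{C̲}` into `Π^tp_{C̲}`; `l` odd). (toy bookkeeping) [cite: MochizukiEtTh2009, Cor 2.9 p.43] -/
theorem right_of_mem_normalizer_tpPiCu (hl : Odd l) {x : GtpB l}
    (hx : x ∈ Subgroup.normalizer (((heisPiCu l).comap (PhiG l) : Subgroup (GtpB l)) : Set (GtpB l))) :
    (PhiG l x).right = 1 ∨ (PhiG l x).right = DihedralGroup.sr 0 := by
  have hι : iotaG l ∈ (heisPiCu l).comap (PhiG l) := Or.inr rfl
  have h := (Subgroup.mem_normalizer_iff.mp hx (iotaG l)).mp hι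
  have h' : (PhiG l (x * iotaG l * x⁻¹)).right = 1 ∨ (PhiG l (x * iotaG l * x⁻¹)).right = DihedralGroup.sr 0 := h
  rw [map_mul, map_mul, map_inv, SemidirectProduct.mul_right, SemidirectProduct.mul_right,
    SemidirectProduct.inv_right] at h'
  exact dihedral_conj_sr_zero l hl h'

omit [NeZero l] in
/-- **The rotation index of the `D_l`-part is an invariant of the double cosets `N(Π^tp_{C̲}) · g · cuspStabC`**: left
multiplication by `1` or `s` and right multiplication by `1` do not change it. (toy bookkeeping) [cite: MochizukiEtTh2009, Cor 2.9 p.43] -/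
theorem rotIdx_mul_invariant {d₁ d d₂ : DihedralGroup l} (h₁ : d₁ = 1 ∨ d₁ = DihedralGroup.sr 0) (h₂ : d₂ = 1) :
    rotIdx l (d₁ * d * d₂) = rotIdx l d := by
  subst h₂
  rw [mul_one]
  rcases h₁ with rfl | rfl
  · rw [one_mul]
  · rcases d with i | i
    · rw [DihedralGroup.sr_mul_r, zero_add, rotIdx_sr, rotIdx_r]
    · rw [DihedralGroup.sr_mul_sr, sub_zero, rotIdx_sr, rotIdx_r]

omit [NeZero l] in
/-- `(ℤ/l × ℤ/l) ⋊ 1 = heisPiCu ∩ heisPiX` (trivial `D_l`-part) is normal in the toy group. (toy bookkeeping)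
[cite: MochizukiEtTh2009, Def 2.1 p.36] -/
theorem heisPiXu_normal : (heisPiCu l ⊓ heisPiX l).Normal := by
  refine ⟨fun x hx g => ?_⟩
  rw [mem_heisPiCu_inf] at hx ⊢
  rw [SemidirectProduct.mul_right, SemidirectProduct.mul_right, SemidirectProduct.inv_right, hx, mul_one,
    mul_inv_cancel]

/-! ## 2. The model and the verdict -/

/-- **THE TWISTED NV-L2 MODEL refutes the typed `Cor29_preserved`.**  For every odd `l ≥ 3` there is a
`T : ThetaCovers.TemperedCoverData l` — finite factor `B = ((ℤ/l)² ⋊ heisPiC l) × ℤ/2`, `Π^tp_C = B × ℤ ↪ Π_C = B × Ẑ`,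
`G_K = 1`, `D_x = ⟨(m₀, η_ℤ 1)⟩` — such that (1) `K ⊇ μ_l` (`HasMuL`); (2) the cusp stabiliser `cuspStabC = N_{Π^tp_C}(tp D_x)`
is `Π^tp_{X̲}` (a proper normal subgroup); (3) `¬ T.Cor29_preserved`: conjugation by the inversion `ι̲` stabilises the
Prop 2.4 list of `C̲` and `cuspStabC` but moves the `Aut_K(C̲)`-orbit of the cusp over the rotation `r¹` to the one over
`r⁻¹`.  CONSISTENCY/INDEPENDENCE certificate on the typed interface only. [cite: MochizukiEtTh2009, Cor 2.9 p.43] -/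
theorem exists_model_not_cor29_preserved (hl : Odd l) (h3 : 3 ≤ l) : ∃ T : TemperedCoverData.{0} l,
    T.HasMuL ∧ T.cuspStabC = T.tp T.PiXu ∧ ¬ T.Cor29_preserved := by
  haveI : Fact (2 < l) := ⟨h3⟩
  haveI := TBX_normal l
  haveI : ((TBX l).prod (⊥ : Subgroup (Multiplicative ℤ))).Normal := Subgroup.prod_normal _ _
  haveI : (heisPiX l).Normal := MonoidHom.normal_ker _
  haveI := heisPiXu_normal l
  haveI : ((heisPiCu l ⊓ heisPiX l).comap (PhiG l)).Normal := Subgroup.Normal.comap inferInstance _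
  haveI : ((heisPiX l).comap (PhiG l)).Normal := Subgroup.Normal.comap inferInstance _
  haveI : (TB.two l).ker.Normal := MonoidHom.normal_ker _
  haveI : (((TBX l ⊓ (TB.two l).ker)).prod (⊥ : Subgroup (Multiplicative ℤ))).Normal := Subgroup.prod_normal _ _
  let T : TemperedCoverData.{0} l :=
    { toCoverDataAx := coverDataAx l hl
      PiCuu := PiCuuB l
      isTypeLTorsThetaPm := isTypeLTorsThetaPm_PiCuuB l hl
      isOpen_PiCuu' := isOpen_PiCuuB l
      Gtp := GtpB l
      toHat := (toHatB l).toMonoidHom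
      continuous_toHat := (toHatB l).continuous
      injective_toHat := toHatB_injective l
      isProfiniteCompletion_toHat := isProfiniteCompletion_toHatB l
      PiYtp := (TBX l).prod ⊥
      PiYtp_le := by
        change (TBX l).prod ⊥ ≤ (PiXB l).comap (toHatB l).toMonoidHom
        rw [comap_toHatB_PiXB]
        exact Subgroup.prod_mono le_rfl bot_le
      PiYtp_normal := inferInstance
      isOpen_PiYtp := isOpen_discrete _
      quotZ := nonempty_quotZ l
      PiYddtp := ((TBX l ⊓ (TB.two l).ker)).prod ⊥
      PiYddtp_le := Subgroup.prod_mono inf_le_left le_rfl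
      isOpen_PiYddtp := isOpen_discrete _
      relIndex_PiYddtp := relIndex_PiYddtp l
      PiCdot := ((TB.two l).ker).prod ⊤
      index_PiCdot := index_PiCdot l
      isOpen_PiCdot := isOpen_discrete _
      PiCdot_ne := PiCdot_ne l }
  -- the tempered members of the list of `C̲` and the cusp stabiliser, concretely
  have hCu : T.tp T.PiCu = (heisPiCu l).comap (PhiG l) := tp_PiCu l
  have hXu : T.tp T.PiXu = (heisPiCu l ⊓ heisPiX l).comap (PhiG l) := tp_PiXu l
  have hX : T.tp T.PiX = (heisPiX l).comap (PhiG l) := tp_PiX l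
  have hstab : T.cuspStabC = (heisPiCu l ⊓ heisPiX l).comap (PhiG l) := by
    change Subgroup.normalizer (((DxB l).comap (toHatB l).toMonoidHom : Subgroup (GtpB l)) : Set (GtpB l)) = _
    rw [tp_Dx]
    exact normalizer_zpowers_genG l h3
  have hμ : T.HasMuL := fun c t ht => hasMuL_model l hl c ht
  -- `Γ :=` conjugation by the inversion `ι̲`
  let Γ : T.Gtp ≃ₜ* T.Gtp :=
    { MulAut.conj (iotaG l) with
      continuous_toFun := continuous_of_discreteTopology
      continuous_invFun := continuous_of_discreteTopology }
  have hΓ : ∀ S' : Subgroup (GtpB l), iotaG l ∈ Subgroup.normalizer (S' : Set (GtpB l)) →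
      S'.map Γ.toMulEquiv.toMonoidHom = S' := fun S' h => by
    rw [MulEquiv.toMonoidHom_eq_coe]
    exact Subgroup.mem_normalizer_iff_map_conj_eq.mp h
  have hnormal : ∀ S' : Subgroup (GtpB l), S'.Normal → S'.map Γ.toMulEquiv.toMonoidHom = S' := fun S' hS' =>
    hΓ S' (Subgroup.le_normalizer_of_normal (Subgroup.mem_top (iotaG l)))
  refine ⟨T, hμ, hstab.trans hXu.symm, fun hC => ?_⟩
  -- a lift of the rotation `r¹`
  let gR : GtpB l := (TB.inH l (SemidirectProduct.inr (DihedralGroup.r 1)) 1, 1)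
  have key := hC hμ (T.tp T.PiCu, [T.tp T.PiCu, T.tp T.PiXu, T.tp T.PiX, T.PiYddtp]) (by simp) Γ ?_ ?_ gR
  rotate_left
  · -- `Γ` stabilises the list of `C̲`
    intro S' hS'
    simp only [List.mem_cons, List.not_mem_nil, or_false] at hS'
    rcases hS' with rfl | rfl | rfl | rfl
    · refine hΓ _ ?_
      rw [hCu]
      exact Subgroup.le_normalizer (show iotaG l ∈ (heisPiCu l).comap (PhiG l) from Or.inr rfl)
    · rw [hXu]; exact hnormal _ inferInstance
    · rw [hX]; exact hnormal _ inferInstance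
    · exact hnormal _ inferInstance
  · -- `Γ` stabilises the cusp stabiliser
    rw [hstab]; exact hnormal _ inferInstance
  -- the double cosets of `gR` and `Γ gR = ι̲ gR ι̲⁻¹` differ: rotation index `1` vs `−1`
  change DoubleCoset.mk (Subgroup.normalizer ((T.tp T.PiCu : Subgroup (GtpB l)) : Set (GtpB l))) T.cuspStabC
      (iotaG l * gR * (iotaG l)⁻¹) = DoubleCoset.mk _ _ gR at key
  rw [DoubleCoset.eq] at key
  obtain ⟨x, hx, y, hy, hxy⟩ := key
  rw [hCu] at hx
  rw [hstab] at hy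
  have hx' := right_of_mem_normalizer_tpPiCu l hl hx
  have hy' : (PhiG l y).right = 1 := (mem_heisPiCu_inf l).mp hy
  have e := congrArg (fun z : GtpB l => rotIdx l (PhiG l z).right) hxy
  simp only [map_mul, map_inv, SemidirectProduct.mul_right, SemidirectProduct.inv_right] at e
  rw [rotIdx_mul_invariant l hx' hy'] at e
  have eR : PhiG l gR = SemidirectProduct.inr (DihedralGroup.r 1) := rfl
  have eι : PhiG l (iotaG l) = SemidirectProduct.inr (DihedralGroup.sr 0) := rfl
  rw [eR, eι, SemidirectProduct.right_inr, SemidirectProduct.right_inr, rotIdx_r, DihedralGroup.inv_sr,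
    DihedralGroup.sr_mul_r, DihedralGroup.sr_mul_sr, zero_add, zero_sub, rotIdx_r] at e
  exact ZMod.neg_one_ne_one e.symm

/-- **FACT-LIST F-0601 (`Cor29_preserved`), SCHEMA VERDICT: the universal closure over `T : TemperedCoverData l` of the
typed last sentence of [EtTh] Cor. 2.9 is FALSE** (`l` odd, `l ≥ 3`) — refuted at the twisted NV-L2 model, where an inner
automorphism (conjugation by the inversion of `C̲`) stabilises everything the typed statement asks for and still permutes
the `Aut_K(C̲)`-orbits of cusps non-trivially.  The row is a SCHEMA consumed BY NAME; together with abc-iut-f-142 gen 0's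
`exists_model_cor29_preserved_not_cor29_card` (it HOLDS at the untwisted model) it is independent of the interface.
[cite: MochizukiEtTh2009, Cor 2.9 p.43] -/
theorem not_forall_cor29_preserved (hl : Odd l) (h3 : 3 ≤ l) :
    ¬ ∀ T : TemperedCoverData.{0} l, T.Cor29_preserved := by
  obtain ⟨T, -, -, hT⟩ := exists_model_not_cor29_preserved l hl h3
  exact fun h => hT (h T)

/-- … even under the hypothesis `K ⊇ μ_l` made explicit (it is the antecedent of the typed statement and HOLDS at the
model, so the failure is not vacuity-related). [cite: MochizukiEtTh2009, Cor 2.9 p.43] -/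
theorem not_forall_cor29_preserved_of_hasMuL (hl : Odd l) (h3 : 3 ≤ l) :
    ¬ ∀ T : TemperedCoverData.{0} l, T.HasMuL → T.Cor29_preserved := by
  obtain ⟨T, hμ, -, hT⟩ := exists_model_not_cor29_preserved l hl h3
  exact fun h => hT (h T hμ)

/-- The same at `l = 3`, closed form. [cite: MochizukiEtTh2009, Cor 2.9 p.43] -/
theorem not_forall_cor29_preserved_three : ¬ ∀ T : TemperedCoverData.{0} 3, T.Cor29_preserved :=
  not_forall_cor29_preserved 3 ⟨1, rfl⟩ le_rfl

end TwistedModel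

end ThetaCovers

end Literature.AnabelianGeometry.EtaleTheta
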